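import Literature.AlgebraicGeometry.HodgeTheory.PicardLefschetzNodalFormsFlat
import HarnessLib

/-!
# The flat Picard–Lefschetz packages: implications and the «data at any radius» shape (theorems only)

Family `hodge`, layer `Literature/AlgebraicGeometry/HodgeTheory`; companion of `PicardLefschetzNodalFormsFlat` (the three
definitions `IsExchangePicardLefschetzData`, `picardLefschetz_nodalForms_flat`, `picardLefschetz_nodalForms_flatExchange`).
Written by the prover seat `hodge-nonav-19716-p2` (g10, cell `hodge-nonav`) for crux K1-B `VeryGeneralSignCommutatorsInHg`
(route `HodgeConjecture/SignSymmetricPowers`, stmt-HodgeConjecture-19716), programme «W-ELIM» brick 4.  Theorems only (no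
definition, no named fact, no `sorry`):

* `IsEquivariantPicardLefschetzData.isExchange` — the equivariant rule implies the exchange rule (its second clause);
* `picardLefschetz_nodalForms_flatExchange_of_uniform`, `picardLefschetz_nodalForms_flat_of_flatExchange`,
  `picardLefschetz_nodalForms_flat_of_uniform`, `picardLefschetz_nodalForms_of_flat` — the graded series
  `_uniform ⟹ _flatExchange ⟹ _flat ⟹ picardLefschetz_nodalForms`;
* `picardLefschetz_nodalForms_flat.exists_isPicardLefschetzData_of_radius` — Picard–Lefschetz data at ANY radius inside
  the punctured disc of nonsingular members, from the flat package (verbatim `PencilCircleHomotopy` §6, which never used the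
  equivariance clause).

Nothing here says HC is proved.

## References

* [VoisinHodgeII2003] C. Voisin, Hodge Theory and Complex Algebraic Geometry II, CUP 2003: §2.2.1 Def. 2.12, §2.3.1,
  §3.1.2, §3.2.1 Thm. 3.16, Cor. 3.17, Rem. 3.21, §3.2.2.
* [ArnoldGuseinzadeVarchenko2012] V. I. Arnold, S. M. Gusein-Zade, A. N. Varchenko, Singularities of Differentiable Maps,
  Vol. 2: Part I §1.3, §5.1 Thm. 5.1, p. 67 Corollary.
* [Hatcher2002] A. Hatcher, Algebraic Topology, §1.1 Lemma 1.19.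
-/

noncomputable section

open CategoryTheory AlgebraicGeometry MvPolynomial
open Literature.AlgebraicTopology.SingularHomology
open Literature.AlgebraicGeometry.Motives Literature.AlgebraicGeometry.Motives.UniversalHypersurface

namespace Literature.AlgebraicGeometry.HodgeTheory

section HodgeTheory

variable {n d : ℕ}

/-! ### §1 The exchange rule is the second clause of the equivariant rule -/

/-- The equivariant sign rule implies the exchange rule (it is its second clause).
[cite: ArnoldGuseinzadeVarchenko2012, Part I §5.1 Thm. 5.1 and p. 67 Corollary] -/
theorem IsEquivariantPicardLefschetzData.isExchange {k : ℕ} {f₁ g : MvPolynomial (Fin (n + 2)) ℂ}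
    {p : Fin k → Fin (n + 2) → ℂ} {s' : ComplexPoints (base ℂ n d)}
    {δ : Fin k → bettiCohomology (fiberOver (family ℂ n d) s') n}
    (h : IsEquivariantPicardLefschetzData n d k f₁ g p δ) : IsExchangePicardLefschetzData n d k f₁ g p δ :=
  fun a ha h₁ hg σ' hσ' => (h a ha h₁ hg σ' hσ').2

/-! ### §2 The graded series -/

/-- The uniform statement (flat coefficient + full equivariant rule) implies the flat package with the exchange rule:
keep the coefficient, the radius and the data; drop Wall's sign clause. [cite: VoisinHodgeII2003, §3.2.1 Thm. 3.16]
[cite: ArnoldGuseinzadeVarchenko2012, Part I §5.1 Thm. 5.1] -/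
theorem picardLefschetz_nodalForms_flatExchange_of_uniform (H : picardLefschetz_nodalForms_uniform) :
    picardLefschetz_nodalForms_flatExchange := by
  intro n d hn hd hU
  obtain ⟨c, hc, hrest⟩ := H n d hn hd hU
  refine ⟨c, hc, fun k f₁ g hf hg p hp hgp => ?_⟩
  obtain ⟨ε₀, hε₀, hsm, hcirc⟩ := hrest k f₁ g hf hg p hp hgp
  refine ⟨ε₀, hε₀, hsm, fun ε h0 h1 s' hs' γ hγ => ?_⟩
  obtain ⟨δ, hPL, hEq⟩ := hcirc ε h0 h1 s' hs' γ hγ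
  exact ⟨δ, hPL, hEq.isExchange⟩

/-- The flat package with the exchange rule implies the flat package (drop the exchange clause).
[cite: VoisinHodgeII2003, §3.2.1 Thm. 3.16] -/
theorem picardLefschetz_nodalForms_flat_of_flatExchange (H : picardLefschetz_nodalForms_flatExchange) :
    picardLefschetz_nodalForms_flat := by
  intro n d hn hd hU
  obtain ⟨c, hc, hrest⟩ := H n d hn hd hU
  refine ⟨c, hc, fun k f₁ g hf hg p hp hgp => ?_⟩
  obtain ⟨ε₀, hε₀, hsm, hcirc⟩ := hrest k f₁ g hf hg p hp hgp
  refine ⟨ε₀, hε₀, hsm, fun ε h0 h1 s' hs' γ hγ => ?_⟩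
  obtain ⟨δ, hPL, -⟩ := hcirc ε h0 h1 s' hs' γ hγ
  exact ⟨δ, hPL⟩

/-- The uniform statement implies the flat package. [cite: VoisinHodgeII2003, §3.2.1 Thm. 3.16] -/
theorem picardLefschetz_nodalForms_flat_of_uniform (H : picardLefschetz_nodalForms_uniform) :
    picardLefschetz_nodalForms_flat :=
  picardLefschetz_nodalForms_flat_of_flatExchange (picardLefschetz_nodalForms_flatExchange_of_uniform H)

/-- The flat package implies the plain named fact `picardLefschetz_nodalForms`: take the coefficient `c(s')`; the
radius `ε₀` is extracted for the canonical trivialisation datum `isCohomologicallyLocallyTrivialOn_family` and serves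
every `hU` by proof irrelevance. [cite: VoisinHodgeII2003, §3.2.1 Thm. 3.16] -/
theorem picardLefschetz_nodalForms_of_flat (H : picardLefschetz_nodalForms_flat) :
    picardLefschetz_nodalForms := by
  intro n d k hn hd f₁ g hf hg p hp hgp
  obtain ⟨c, -, hc⟩ := H n d hn hd
    (UniversalHypersurface.isCohomologicallyLocallyTrivialOn_family n d hd)
  obtain ⟨ε₀, hε₀, hsm, hrest⟩ := hc k f₁ g hf hg p hp hgp
  refine ⟨ε₀, hε₀, hsm, fun hU ε h0 h1 s' hs' γ hγ ↦ ?_⟩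
  obtain ⟨δ, hPL⟩ := hrest ε h0 h1 s' hs' γ hγ
  exact ⟨δ, c s', hPL⟩

/-! ### §3 Consumer shape: Picard–Lefschetz data at any radius, from the flat package -/

/-- **Picard–Lefschetz data for a circle of ANY radius inside the punctured disc of nonsingular members**, from the
flat package (verbatim `picardLefschetz_nodalForms_uniform.exists_isPicardLefschetzData_of_radius` of
`PencilCircleHomotopy` §6, which never used the equivariance clause): for `n, d ≥ 1` and every `hU` there is a flat
coefficient `c` such that for every `k`-nodal `f₁` with nodes `p`, every `g` missing the nodes, and every radius `r > 0`
with all `f₁ + c'·g`, `0 < |c'| ≤ r`, nonsingular, every circle `γ` of radius `r` of the pencil at the point `s` of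
`f₁ + r·g` carries Picard–Lefschetz data with coefficient `c(s)`.  Proof: data at a radius `ε < min(ε₀, r)` from the
fact, moved to radius `r` by `IsPicardLefschetzData.exists_of_concentric`.
[cite: VoisinHodgeII2003, §3.2.1 Thm. 3.16, §3.2.2, §3.1.2 and §2.3.1] [cite: Hatcher2002, §1.1 Lemma 1.19 (p. 37)] -/
theorem picardLefschetz_nodalForms_flat.exists_isPicardLefschetzData_of_radius
    (H : picardLefschetz_nodalForms_flat) (n d : ℕ) (hn : 1 ≤ n) (hd : 1 ≤ d)
    (hU : IsCohomologicallyLocallyTrivialOn (family ℂ n d) Set.univ) :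
    ∃ c : ComplexPoints (base ℂ n d) → ℚ, IsFlatCoefficient n d hn hd hU c ∧
      ∀ (k : ℕ) (f₁ g : MvPolynomial (Fin (n + 2)) ℂ), f₁.IsHomogeneous d → g.IsHomogeneous d →
        ∀ (p : Fin k → Fin (n + 2) → ℂ), IsNodalFormWithNodes f₁ p → (∀ i, eval (p i) g ≠ 0) →
          ∀ (r : ℝ), 0 < r →
            (∀ c' : ℂ, c' ≠ 0 → ‖c'‖ ≤ r → SmoothHypersurface.IsNonsingularForm ℂ (f₁ + c' • g)) →
              ∀ (s : ComplexPoints (base ℂ n d)), pointForm ℂ n d s = f₁ + (r : ℂ) • g →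
                ∀ (γ : Path s s), IsPencilCircle n d f₁ g r γ →
                  ∃ δ : Fin k → bettiCohomology (fiberOver (family ℂ n d) s) n,
                    IsPicardLefschetzData n d k hn hd hU γ δ (c s) := by
  obtain ⟨c, hc, hPL⟩ := H n d hn hd hU
  refine ⟨c, hc, fun k f₁ g hf₁ hg p hp hgp r hr hJr s hs γ hγ => ?_⟩
  obtain ⟨ε₀, hε₀, -, hrest⟩ := hPL k f₁ g hf₁ hg p hp hgp
  -- an infinitesimal radius `ε` inside `(0, r]`
  obtain ⟨ε, hε0, hε1, hεr⟩ : ∃ ε : ℝ, 0 < ε ∧ ε < ε₀ ∧ ε ≤ r :=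
    ⟨min (ε₀ / 2) r, lt_min (half_pos hε₀) hr, lt_of_le_of_lt (min_le_left _ _) (half_lt_self hε₀),
      min_le_right _ _⟩
  -- members of norm in `[ε, r]` are nonsingular
  have hJεr : ∀ c' : ℂ, ‖c'‖ ∈ Set.uIcc r ε → SmoothHypersurface.IsNonsingularForm ℂ (f₁ + c' • g) := by
    intro c' hc'
    rw [Set.uIcc_of_ge hεr] at hc'
    have hne : c' ≠ 0 := fun h0 => by
      rw [h0, norm_zero] at hc'
      exact absurd hc'.1 (not_le.2 hε0)
    exact hJr c' hne hc'.2
  -- the point `s₁` of `f₁ + ε g` and the circle `γ₁` of radius `ε` there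
  have hJε : ∀ c' : ℂ, ‖c'‖ = |ε| → SmoothHypersurface.IsNonsingularForm ℂ (f₁ + c' • g) := fun c' hc' =>
    hJεr c' (by rw [hc', abs_of_pos hε0, Set.uIcc_of_ge hεr]; exact ⟨le_rfl, hεr⟩)
  obtain ⟨s₁, hs₁⟩ := exists_point_of_isNonsingularForm ℂ n d (isHomogeneous_add_smul hf₁ hg (ε : ℂ))
    (hJε _ (by rw [Complex.norm_real, Real.norm_eq_abs]))
  obtain ⟨γ₁, hγ₁⟩ := exists_isPencilCircle hf₁ hg hJε s₁ hs₁
  -- Picard–Lefschetz data at radius `ε`, moved to radius `r`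
  obtain ⟨δ₁, hPL₁⟩ := hrest ε hε0 hε1 s₁ hs₁ γ₁ hγ₁
  exact hPL₁.exists_of_concentric hc hf₁ hg hr.le hε0.le hJεr hs hs₁ hγ hγ₁

end HodgeTheory

end Literature.AlgebraicGeometry.HodgeTheory

end
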